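import Literature.MathematicalPhysics.QuantumFieldTheory.Balaban1983to89.B8Eq131CubesRec

/-!
# `Balaban1983to89.B8Eq131CubesRecDictionary` — [Balaban1985RegularSpaces] p. 98 ∕ (1.131): the cube family `□ ⊂ □_k ⊂ … ⊂ □₀ ⊂ □̃`, `Λ′_j`, read on the
# RECORD's CENTRED tower ([Balaban1987RG1] (0.3)) — `B8Eq131CubesRec` — IS the engine's corner-anchored family `B8Eq131Cubes` TRANSLATED BY `−ctrShift L n·𝟙`
# at depth `n` (the N05-REC «(T2) translation», LEAD ask L1, as LEMMAS)

statement-level bookkeeping between two typed families of published objects, with citation tags; nothing here is a claim about the Yang–Mills mass gap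

CITATION HEADER.  [6] = [Balaban1985RegularSpaces] (T. Bałaban, *Spaces of regular gauge field configurations on a lattice and gauge fixing conditions*, Commun. Math.
Phys. **99** (1985) 75–102), p. 98: *«Let us take a sequence of cubes □₀, □₁, …, □_{k−1}, □_k, □, such that □_j ⊃ □_{j+1} … for every j the cube □_j is a sum of the big
blocks of the lattice T_{L^{−j}}»*, (1.131) p. 99 *«Λ′_j = □_j^{(j)} ∖ □_{j+1}^{(j)}, …»*; [I] = [Balaban1987RG1] (T. Bałaban, *Renormalization group approach to lattice
gauge field theories. I*, Commun. Math. Phys. **109** (1987) 249–301), (0.3) p. 252: the CENTRED blocks *«Bᵏ(y) = {x : |x_μ − Lᵏy_μ| ≤ (Lᵏ−1)∕2}»* versus [6] (1.6) p. 77's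
corner blocks `Lᵏy + [0, Lᵏ)ᵈ`.  Cell `pub-ymgap`, width seat `pub-ymgap-dag-n07-w3` g10, «N05-REC» road item R7 (the NODE 00 bridge), `R7-DOOR-PLAN.md` row A4 («cube datum of the
twin at `cornerP ∕ sideP`: geometry = LOCATED-L1, pure (T2) translation»).  CONSUMED BY NAME, nothing modified: dag-n05-d's R4e `B8Eq131CubesRec` (`bLoZ bHiZ sqLoZ sqHiZ inLoZ inHiZ
boxZ cubeZ tcubeZ LamPZ`, `cube_eq`, `tcube_eq`), dag-n05-d's `B8Ineq130Rec` (centred tower `tlo ∕ thi`, `tlo_apply`, `thi_apply`, `tlo_eq_engine_sub`, `thi_eq_engine_sub`) and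
`B8Eq119TwistedAxialRec` (`UnderZ`, `flmZ`, `ctrShift_add`, `ctrShift_zero`), dag-n05-e's `BlockAveragingZd` (`ctrShift`, `two_mul_ctrShift_add_one`), the engine `B8Eq131Cubes`
(`bLo bHi sqLo sqHi inLo inHi box cube tcube LamP flm`, `cube_eq`, `tcube_eq`), `B8Ineq130` (`tlo ∕ thi`, `tlo_apply`, `thi_apply`), `B8Ineq132.Under`, `B7Prop1Local.InBox`.
`--kind proof --supports stmt-QuantumFields-20541` (K0⁷; count-neutral).  THEOREMS ONLY.

WHY.  The R7 door re-keys the torus rows of N07's `HThm4Rec` — stated on `cover '' box (F.P K).L (cornerP …) (sideP …) j` and `cover '' cube … ρ j j′`, the ENGINE family in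
cover coordinates — onto the record crown's rows, which live on `boxZ ∕ cubeZ ∕ tcubeZ` under the TOP-ANCHORED lift `x ↦ cover (x + ctrShift L k·𝟙)` of this lineage's FILE 39
(`Node00.TorusCoverBlockAveragingZd`: level-`j` objects read at `+ ctrShift L (k−j)·𝟙`).  For the SAME unit-lattice datum `(a, M, ρ, k)` the two families differ by exactly these
translations: fine sites by `c_k := ctrShift L k`, depth-`n` labels by `c_n`, and `c_k = Lʲ·c_{k−j} + c_j` ties the levels (`ctrShift_add`).  This module states that dictionary
once, in the spelling `x + fun _ => (ctrShift L n : ℤ)` of FILE 39 ∕ FILE 43, so that the door can quote it by name.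

WHAT IS PROVED (sorry-free; every statement an identity of sets ∕ boxes under translation by a constant vector).
* §1 corners: `bLoZ_apply` ∕ `bHiZ_apply` (`= bLo ∕ bHi − c_n` coordinatewise), vector forms `bLoZ_eq_bLo_sub` ∕ `bHiZ_eq_bHi_sub`, the label corners `sqLoZ_apply ∕ sqHiZ_apply ∕
  inLoZ_apply ∕ inHiZ_apply` (depth `k − j`), and the depth-`0` coincidences `bLoZ_zero ∕ bHiZ_zero ∕ boxZ_zero` (`c₀ = 0`: the unit-lattice cube `□^{(k)} = [a, a + M − 1]ᵈ` is shared).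
* §2 windows: `inBox_sub_const_iff` (generic), ★ `inBox_tloZ_thiZ_iff_add_ctrShift` and `tloZ_le_iff_add_ctrShift ∕ le_thiZ_iff_add_ctrShift` (the centred tower window
  `[tlo, thi]` of `B8Ineq130Rec` at depth `n` is the engine window of `B8Ineq130` read at `x + c_n`).
* §3 the family: ★ `mem_boxZ_iff_add_ctrShift` (`x ∈ boxZ L a M k ↔ x + c_k ∈ box L a M k`), ★★ `mem_cubeZ_iff_add_ctrShift'` (all `j`, shift `c_{(k−j)+j}`) and
  `mem_cubeZ_iff_add_ctrShift` (`j ≤ k`, shift `c_k`), ★★ `mem_tcubeZ_iff_add_ctrShift` (`□̃`, shift `c_k`), the label boxes `inBox_sqZ_iff_add_ctrShift ∕ inBox_inZ_iff_add_ctrShift`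
  (shift `c_{k−j}`), `inBox_sqZ_top_iff` (top labels coincide), ★★ `mem_lamPZ_iff_add_ctrShift` (`1 ≤ k`: `z ∈ LamPZ … j ↔ z + c_{k−j} ∈ LamP … j`, every `j`).
* §4 image ∕ preimage forms: `boxZ_eq_preimage ∕ image_add_ctrShift_boxZ` (`(· + c_k) '' boxZ = box`), `cubeZ_eq_preimage ∕ image_add_ctrShift_cubeZ`,
  `tcubeZ_eq_preimage ∕ image_add_ctrShift_tcubeZ`.
* §5 blocks: ★ `underZ_iff_under_add_ctrShift` (`m ≤ n`: `UnderZ L m y x ↔ Under L m (y + c_{n−m}) (x + c_n)`) and ★ `flm_add_ctrShift` (`flm L m (x + c_n) = flmZ L m x + c_{n−m}`) —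
  the `Under ∕ flm` companions of FILE 43's `mem_blockSitesZ_iff_add_ctrShift_mem_blockSites`, i.e. what `Node00.CubeB8D.blocks ∕ inTop ∕ lamS` read.
HONEST SCOPE.  Pure translation bookkeeping on `ℤᵈ` (odd `L` where the centred tower enters); no estimate of [6] ∕ [I] asserted; `HThm4Rec` UNDISCHARGED (caveat (C-S3-1)); N05 ∕ N07
NOT discharged; counts unmoved; one finite 𝕋⁴ programme at fixed ε — R4 closes the conditional finite-𝕋⁴ rung `BalabanLadder.UV` only; the YM mass gap (Clay) is NOT proved by any of
this; nothing continuum ∕ ℝ⁴ ∕ OS.  No `def`, no `instance`, no `notation`, no `sorry`.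
-/

namespace Literature.MathematicalPhysics.QuantumFieldTheory.Balaban1983to89.B8Eq131CubesRecDictionary

-- `Site` alone would resolve to the torus sites of `Setup.lean`; re-export the `ℤᵈ` sites of `B7Prop1Explicit` (as `B8Eq131CubesRec` does).
export B7Prop1Explicit (Site)

open B7Prop1Local (InBox)
open BlockAveragingZd (ctrShift two_mul_ctrShift_add_one)
open B8Eq119TwistedAxialRec (UnderZ flmZ ctrShift_add ctrShift_zero)
open B8Ineq132 (Under)
open B8Eq131Cubes (bLo bHi sqLo sqHi inLo inHi cube tcube LamP flm gs)
open B8Eq131CubesRec (bLoZ bHiZ sqLoZ sqHiZ inLoZ inHiZ boxZ cubeZ tcubeZ LamPZ)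

variable {d : ℕ}

/-! ## §1. Corners: the centred boxes are the engine boxes shifted by `−c_n`, `c_n = ctrShift L n = (Lⁿ − 1)∕2` -/

/-- `bLoZ L a n m = bLo L a n m − c_n` coordinatewise (any `L`). [cite: Balaban1985RegularSpaces, p.98; Balaban1987RG1, (0.3) p.252] -/
theorem bLoZ_apply (L : ℕ) (a : Site d) (n m : ℕ) (i : Fin d) :
    bLoZ L a n m i = bLo L a n m i - ctrShift L n := by
  simp only [bLoZ, bLo]; ring

/-- `bHiZ L a M n m = bHi L a M n m − c_n` coordinatewise (any `L`). [cite: Balaban1985RegularSpaces, p.98; Balaban1987RG1, (0.3) p.252] -/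
theorem bHiZ_apply (L : ℕ) (a : Site d) (M n m : ℕ) (i : Fin d) :
    bHiZ L a M n m i = bHi L a M n m i - ctrShift L n := by
  simp only [bHiZ, bHi]; ring

/-- Vector form: `bLoZ L a n m = bLo L a n m − c_n·𝟙`. [cite: Balaban1985RegularSpaces, p.98; Balaban1987RG1, (0.3) p.252] -/
theorem bLoZ_eq_bLo_sub (L : ℕ) (a : Site d) (n m : ℕ) :
    bLoZ L a n m = bLo L a n m - fun _ => (ctrShift L n : ℤ) := by
  funext i; rw [Pi.sub_apply, bLoZ_apply]

/-- Vector form: `bHiZ L a M n m = bHi L a M n m − c_n·𝟙`. [cite: Balaban1985RegularSpaces, p.98; Balaban1987RG1, (0.3) p.252] -/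
theorem bHiZ_eq_bHi_sub (L : ℕ) (a : Site d) (M n m : ℕ) :
    bHiZ L a M n m = bHi L a M n m - fun _ => (ctrShift L n : ℤ) := by
  funext i; rw [Pi.sub_apply, bHiZ_apply]

/-- Label corner of `□_j^{(j)}` (depth `k − j`): `sqLoZ = sqLo − c_{k−j}`. [cite: Balaban1985RegularSpaces, p.98 ("a distance between boundaries of these cubes is equal to R₁M₁Lʲη"); Balaban1987RG1, (0.3) p.252] -/
theorem sqLoZ_apply (L : ℕ) (a : Site d) (ρ k j : ℕ) (i : Fin d) :
    sqLoZ L a ρ k j i = sqLo L a ρ k j i - ctrShift L (k - j) := by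
  unfold sqLoZ sqLo; exact bLoZ_apply L a _ _ i

/-- `sqHiZ = sqHi − c_{k−j}`. [cite: Balaban1985RegularSpaces, p.98; Balaban1987RG1, (0.3) p.252] -/
theorem sqHiZ_apply (L : ℕ) (a : Site d) (M ρ k j : ℕ) (i : Fin d) :
    sqHiZ L a M ρ k j i = sqHi L a M ρ k j i - ctrShift L (k - j) := by
  unfold sqHiZ sqHi; exact bHiZ_apply L a M _ _ i

/-- Inner label corner of `□_{j+1}^{(j)}` (depth `k − j`): `inLoZ = inLo − c_{k−j}`. [cite: Balaban1985RegularSpaces, (1.131) p.99; Balaban1987RG1, (0.3) p.252] -/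
theorem inLoZ_apply (L : ℕ) (a : Site d) (ρ k j : ℕ) (i : Fin d) :
    inLoZ L a ρ k j i = inLo L a ρ k j i - ctrShift L (k - j) := by
  unfold inLoZ inLo; exact bLoZ_apply L a _ _ i

/-- `inHiZ = inHi − c_{k−j}`. [cite: Balaban1985RegularSpaces, (1.131) p.99; Balaban1987RG1, (0.3) p.252] -/
theorem inHiZ_apply (L : ℕ) (a : Site d) (M ρ k j : ℕ) (i : Fin d) :
    inHiZ L a M ρ k j i = inHi L a M ρ k j i - ctrShift L (k - j) := by
  unfold inHiZ inHi; exact bHiZ_apply L a M _ _ i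

/-- Depth `0` (`c₀ = 0`): `bLoZ L a 0 m = bLo L a 0 m` — the unit-lattice cube `□^{(k)}` is shared by the two families. [cite: Balaban1985RegularSpaces, p.98; Balaban1987RG1, (0.3) p.252] -/
theorem bLoZ_zero (L : ℕ) (a : Site d) (m : ℕ) : bLoZ L a 0 m = bLo L a 0 m := by
  funext i; rw [bLoZ_apply, ctrShift_zero]; simp

/-- Depth `0`: `bHiZ L a M 0 m = bHi L a M 0 m`. [cite: Balaban1985RegularSpaces, p.98; Balaban1987RG1, (0.3) p.252] -/
theorem bHiZ_zero (L : ℕ) (a : Site d) (M m : ℕ) : bHiZ L a M 0 m = bHi L a M 0 m := by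
  funext i; rw [bHiZ_apply, ctrShift_zero]; simp

/-- Depth `0`: `boxZ L a M 0 = box L a M 0` (`= [a, a + M − 1]ᵈ`). [cite: Balaban1985RegularSpaces, p.98; Balaban1987RG1, (0.3) p.252] -/
theorem boxZ_zero (L : ℕ) (a : Site d) (M : ℕ) : boxZ L a M 0 = B8Eq131Cubes.box L a M 0 := by
  ext x
  simp only [boxZ, B8Eq131Cubes.box, Set.mem_setOf_eq, bLoZ_zero, bHiZ_zero]

/-! ## §2. Windows: a box translated by a constant vector; the centred tower window of `B8Ineq130Rec` vs the engine window of `B8Ineq130` -/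

/-- Generic: `x ∈ [lo − t, hi − t] ↔ x + t ∈ [lo, hi]`. [cite: Balaban1987RG1, (0.3) p.252 (bookkeeping)] -/
theorem inBox_sub_const_iff (lo hi x t : Site d) :
    InBox (lo - t) (hi - t) x ↔ InBox lo hi (x + t) := by
  simp only [InBox, Pi.add_apply, Pi.sub_apply]
  exact forall_congr' fun i => by constructor <;> rintro ⟨h1, h2⟩ <;> constructor <;> linarith

/-- ★ The CENTRED tower window at depth `n` below `[lo, hi]` (`B8Ineq130Rec.tlo ∕ thi`) is the ENGINE tower window (`B8Ineq130.tlo ∕ thi`) read at `x + c_n` (odd `L`).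
[cite: Balaban1985RegularSpaces, p.98 ("for every j the cube □_j is a sum of the big blocks"); Balaban1987RG1, (0.3) p.252] -/
theorem inBox_tloZ_thiZ_iff_add_ctrShift {L : ℕ} (hL : Odd L) (lo hi : Site d) (n : ℕ) (x : Site d) :
    InBox (B8Ineq130Rec.tlo L lo n) (B8Ineq130Rec.thi L hi n) x ↔
      InBox (B8Ineq130.tlo L lo n) (B8Ineq130.thi L hi n) (x + fun _ => (ctrShift L n : ℤ)) := by
  simp only [InBox, Pi.add_apply, B8Ineq130Rec.tlo_eq_engine_sub hL, B8Ineq130Rec.thi_eq_engine_sub hL]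
  exact forall_congr' fun i => by constructor <;> rintro ⟨h1, h2⟩ <;> constructor <;> linarith

/-- Lower half of the window, `Pi`-order form: `tloZ n ≤ x ↔ tlo n ≤ x + c_n` (odd `L`). [cite: Balaban1985RegularSpaces, p.98; Balaban1987RG1, (0.3) p.252] -/
theorem tloZ_le_iff_add_ctrShift {L : ℕ} (hL : Odd L) (lo : Site d) (n : ℕ) (x : Site d) :
    B8Ineq130Rec.tlo L lo n ≤ x ↔ B8Ineq130.tlo L lo n ≤ x + fun _ => (ctrShift L n : ℤ) := by
  simp only [Pi.le_def, Pi.add_apply, B8Ineq130Rec.tlo_eq_engine_sub hL]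
  exact forall_congr' fun i => by constructor <;> intro h <;> linarith

/-- Upper half of the window, `Pi`-order form: `x ≤ thiZ n ↔ x + c_n ≤ thi n` (odd `L`). [cite: Balaban1985RegularSpaces, p.98; Balaban1987RG1, (0.3) p.252] -/
theorem le_thiZ_iff_add_ctrShift {L : ℕ} (hL : Odd L) (hi : Site d) (n : ℕ) (x : Site d) :
    x ≤ B8Ineq130Rec.thi L hi n ↔ (x + fun _ => (ctrShift L n : ℤ)) ≤ B8Ineq130.thi L hi n := by
  simp only [Pi.le_def, Pi.add_apply, B8Ineq130Rec.thi_eq_engine_sub hL]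
  exact forall_congr' fun i => by constructor <;> intro h <;> linarith

/-! ## §3. The family `□`, `□_j`, `□̃`, the label boxes `□_j^{(j)} ∕ □_{j+1}^{(j)}`, and `Λ′_j` -/

/-- ★ `□` (fine depth `k`): `x ∈ boxZ L a M k ↔ x + c_k ∈ box L a M k`. [cite: Balaban1985RegularSpaces, p.98 ("we take a size of □ equal to MLʲη"); Balaban1987RG1, (0.3) p.252] -/
theorem mem_boxZ_iff_add_ctrShift (L : ℕ) (a : Site d) (M k : ℕ) (x : Site d) :
    x ∈ boxZ L a M k ↔ (x + fun _ => (ctrShift L k : ℤ)) ∈ B8Eq131Cubes.box L a M k := by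
  simp only [boxZ, B8Eq131Cubes.box, Set.mem_setOf_eq, InBox, Pi.add_apply, bLoZ_apply, bHiZ_apply]
  exact forall_congr' fun i => by constructor <;> rintro ⟨h1, h2⟩ <;> constructor <;> linarith

/-- ★★ `□_j`, every `j` (odd `L`): `x ∈ cubeZ L a M ρ k j ↔ x + c_{(k−j)+j} ∈ cube L a M ρ k j` (the label box sits at depth `k − j`, the blow-up is `j`-fold; for `j ≤ k` the
shift is `c_k`, see `mem_cubeZ_iff_add_ctrShift`). [cite: Balaban1985RegularSpaces, p.98 ("for every j the cube □_j is a sum of the big blocks of the lattice T_{L^{-j}}"); Balaban1987RG1, (0.3) p.252] -/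
theorem mem_cubeZ_iff_add_ctrShift' {L : ℕ} (hL : Odd L) (a : Site d) (M ρ k j : ℕ) (x : Site d) :
    x ∈ cubeZ L a M ρ k j ↔ (x + fun _ => (ctrShift L (k - j + j) : ℤ)) ∈ cube L a M ρ k j := by
  have hc : 2 * (ctrShift L j : ℤ) + 1 = (L : ℤ) ^ j := by exact_mod_cast two_mul_ctrShift_add_one hL j
  simp only [cubeZ, cube, Set.mem_setOf_eq, InBox, Pi.add_apply, B8Ineq130Rec.tlo_apply hL, B8Ineq130Rec.thi_apply hL,
    B8Ineq130.tlo_apply, B8Ineq130.thi_apply, sqLoZ_apply, sqHiZ_apply, ctrShift_add hL (k - j) j, mul_sub, mul_add, mul_one]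
  exact forall_congr' fun i => by constructor <;> rintro ⟨h1, h2⟩ <;> constructor <;> linarith

/-- ★★ `□_j` for `j ≤ k` (odd `L`): `x ∈ cubeZ L a M ρ k j ↔ x + c_k ∈ cube L a M ρ k j` — ONE shift `c_k` for the whole family at the fine level.
[cite: Balaban1985RegularSpaces, p.98; Balaban1987RG1, (0.3) p.252] -/
theorem mem_cubeZ_iff_add_ctrShift {L : ℕ} (hL : Odd L) (a : Site d) (M ρ : ℕ) {k j : ℕ} (hj : j ≤ k) (x : Site d) :
    x ∈ cubeZ L a M ρ k j ↔ (x + fun _ => (ctrShift L k : ℤ)) ∈ cube L a M ρ k j := by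
  have h := mem_cubeZ_iff_add_ctrShift' hL a M ρ k j x
  rwa [Nat.sub_add_cancel hj] at h

/-- ★★ `□̃` (odd `L`): `x ∈ tcubeZ L a M ρ k ↔ x + c_k ∈ tcube L a M ρ k`. [cite: Balaban1985RegularSpaces, p.98 ("a cube which we denote by □̃"); Balaban1987RG1, (0.3) p.252] -/
theorem mem_tcubeZ_iff_add_ctrShift {L : ℕ} (hL : Odd L) (a : Site d) (M ρ k : ℕ) (x : Site d) :
    x ∈ tcubeZ L a M ρ k ↔ (x + fun _ => (ctrShift L k : ℤ)) ∈ tcube L a M ρ k := by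
  rw [B8Eq131CubesRec.tcube_eq hL, B8Eq131Cubes.tcube_eq]
  simp only [Set.mem_setOf_eq, InBox, Pi.add_apply, bLoZ_apply, bHiZ_apply]
  exact forall_congr' fun i => by constructor <;> rintro ⟨h1, h2⟩ <;> constructor <;> linarith

/-- The label box `□_j^{(j)}` (depth `k − j`): `z ∈ [sqLoZ, sqHiZ] ↔ z + c_{k−j} ∈ [sqLo, sqHi]`. [cite: Balaban1985RegularSpaces, p.98, (1.133) p.99 ("on □_j^{(j)}"); Balaban1987RG1, (0.3) p.252] -/
theorem inBox_sqZ_iff_add_ctrShift (L : ℕ) (a : Site d) (M ρ k j : ℕ) (z : Site d) :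
    InBox (sqLoZ L a ρ k j) (sqHiZ L a M ρ k j) z ↔
      InBox (sqLo L a ρ k j) (sqHi L a M ρ k j) (z + fun _ => (ctrShift L (k - j) : ℤ)) := by
  simp only [InBox, Pi.add_apply, sqLoZ_apply, sqHiZ_apply]
  exact forall_congr' fun i => by constructor <;> rintro ⟨h1, h2⟩ <;> constructor <;> linarith

/-- The inner label box `□_{j+1}^{(j)}` (depth `k − j`): `z ∈ [inLoZ, inHiZ] ↔ z + c_{k−j} ∈ [inLo, inHi]`. [cite: Balaban1985RegularSpaces, (1.131) p.99; Balaban1987RG1, (0.3) p.252] -/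
theorem inBox_inZ_iff_add_ctrShift (L : ℕ) (a : Site d) (M ρ k j : ℕ) (z : Site d) :
    InBox (inLoZ L a ρ k j) (inHiZ L a M ρ k j) z ↔
      InBox (inLo L a ρ k j) (inHi L a M ρ k j) (z + fun _ => (ctrShift L (k - j) : ℤ)) := by
  simp only [InBox, Pi.add_apply, inLoZ_apply, inHiZ_apply]
  exact forall_congr' fun i => by constructor <;> rintro ⟨h1, h2⟩ <;> constructor <;> linarith

/-- Top labels coincide (depth `0`): `z ∈ [sqLoZ k, sqHiZ k] ↔ z ∈ [sqLo k, sqHi k]` — `Λ′_k = □_k^{(k)}` is the same unit-lattice box for both families.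
[cite: Balaban1985RegularSpaces, (1.131) p.99 ("Λ′_k = □_k^{(k)}"); Balaban1987RG1, (0.3) p.252] -/
theorem inBox_sqZ_top_iff (L : ℕ) (a : Site d) (M ρ k : ℕ) (z : Site d) :
    InBox (sqLoZ L a ρ k k) (sqHiZ L a M ρ k k) z ↔ InBox (sqLo L a ρ k k) (sqHi L a M ρ k k) z := by
  simp only [InBox, sqLoZ_apply, sqHiZ_apply, Nat.sub_self, ctrShift_zero, Nat.cast_zero, sub_zero]

/-- ★★ **(1.131) `Λ′_j`**, every `j`, for `k ≥ 1` (odd `L`): `z ∈ LamPZ L a M ρ k j ↔ z + c_{k−j} ∈ LamP L a M ρ k j` (`Λ′_j`, `1 ≤ j`, lives on the depth-`(k−j)` lattice;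
`Λ′₀ = T ∖ □₁` on the fine one, shift `c_k`). [cite: Balaban1985RegularSpaces, (1.131) p.99; Balaban1987RG1, (0.3) p.252] -/
theorem mem_lamPZ_iff_add_ctrShift {L : ℕ} (hL : Odd L) (a : Site d) (M ρ : ℕ) {k : ℕ} (hk : 1 ≤ k) (j : ℕ) (z : Site d) :
    z ∈ LamPZ L a M ρ k j ↔ (z + fun _ => (ctrShift L (k - j) : ℤ)) ∈ LamP L a M ρ k j := by
  by_cases hj : j = 0
  · subst hj
    have h1 : k - 1 + 1 = k := Nat.sub_add_cancel hk
    simp only [LamPZ, LamP, ite_true, Set.mem_setOf_eq, Nat.sub_zero]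
    rw [mem_cubeZ_iff_add_ctrShift' hL, h1]
  · simp only [LamPZ, LamP, if_neg hj, Set.mem_setOf_eq, inBox_sqZ_iff_add_ctrShift, inBox_inZ_iff_add_ctrShift]

/-! ## §4. Image ∕ preimage forms (the translation `x ↦ x + c_n·𝟙` is a bijection of `ℤᵈ`) -/

/-- `boxZ = (· + c_k) ⁻¹' box`. [cite: Balaban1985RegularSpaces, p.98; Balaban1987RG1, (0.3) p.252] -/
theorem boxZ_eq_preimage (L : ℕ) (a : Site d) (M k : ℕ) :
    boxZ L a M k = (fun x : Site d => x + fun _ => (ctrShift L k : ℤ)) ⁻¹' B8Eq131Cubes.box L a M k := by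
  ext x; rw [Set.mem_preimage]; exact mem_boxZ_iff_add_ctrShift L a M k x

/-- `(· + c_k) '' boxZ = box`. [cite: Balaban1985RegularSpaces, p.98; Balaban1987RG1, (0.3) p.252] -/
theorem image_add_ctrShift_boxZ (L : ℕ) (a : Site d) (M k : ℕ) :
    (fun x : Site d => x + fun _ => (ctrShift L k : ℤ)) '' boxZ L a M k = B8Eq131Cubes.box L a M k := by
  rw [boxZ_eq_preimage]
  exact Set.image_preimage_eq _ fun y => ⟨y - fun _ => (ctrShift L k : ℤ), sub_add_cancel y _⟩

/-- `cubeZ … j = (· + c_k) ⁻¹' cube … j` (`j ≤ k`, odd `L`). [cite: Balaban1985RegularSpaces, p.98; Balaban1987RG1, (0.3) p.252] -/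
theorem cubeZ_eq_preimage {L : ℕ} (hL : Odd L) (a : Site d) (M ρ : ℕ) {k j : ℕ} (hj : j ≤ k) :
    cubeZ L a M ρ k j = (fun x : Site d => x + fun _ => (ctrShift L k : ℤ)) ⁻¹' cube L a M ρ k j := by
  ext x; rw [Set.mem_preimage]; exact mem_cubeZ_iff_add_ctrShift hL a M ρ hj x

/-- `(· + c_k) '' cubeZ … j = cube … j` (`j ≤ k`, odd `L`). [cite: Balaban1985RegularSpaces, p.98; Balaban1987RG1, (0.3) p.252] -/
theorem image_add_ctrShift_cubeZ {L : ℕ} (hL : Odd L) (a : Site d) (M ρ : ℕ) {k j : ℕ} (hj : j ≤ k) :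
    (fun x : Site d => x + fun _ => (ctrShift L k : ℤ)) '' cubeZ L a M ρ k j = cube L a M ρ k j := by
  rw [cubeZ_eq_preimage hL a M ρ hj]
  exact Set.image_preimage_eq _ fun y => ⟨y - fun _ => (ctrShift L k : ℤ), sub_add_cancel y _⟩

/-- `tcubeZ = (· + c_k) ⁻¹' tcube` (odd `L`). [cite: Balaban1985RegularSpaces, p.98; Balaban1987RG1, (0.3) p.252] -/
theorem tcubeZ_eq_preimage {L : ℕ} (hL : Odd L) (a : Site d) (M ρ k : ℕ) :
    tcubeZ L a M ρ k = (fun x : Site d => x + fun _ => (ctrShift L k : ℤ)) ⁻¹' tcube L a M ρ k := by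
  ext x; rw [Set.mem_preimage]; exact mem_tcubeZ_iff_add_ctrShift hL a M ρ k x

/-- `(· + c_k) '' tcubeZ = tcube` (odd `L`). [cite: Balaban1985RegularSpaces, p.98; Balaban1987RG1, (0.3) p.252] -/
theorem image_add_ctrShift_tcubeZ {L : ℕ} (hL : Odd L) (a : Site d) (M ρ k : ℕ) :
    (fun x : Site d => x + fun _ => (ctrShift L k : ℤ)) '' tcubeZ L a M ρ k = tcube L a M ρ k := by
  rw [tcubeZ_eq_preimage hL a M ρ k]
  exact Set.image_preimage_eq _ fun y => ⟨y - fun _ => (ctrShift L k : ℤ), sub_add_cancel y _⟩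

/-! ## §5. Blocks: `Bᵐ(y)` centred vs cornered, and the block label map -/

/-- ★ **Centred block ⇄ corner block** (odd `L`, `m ≤ n`): the fine site `x` lies in the CENTRED `Lᵐ`-block of the label `y` iff `x + c_n` lies in the CORNER `Lᵐ`-block of
`y + c_{n−m}` — fine sites shift by `c_n`, depth-`m`-coarser labels by `c_{n−m}`, `c_n = Lᵐ·c_{n−m} + c_m`. [cite: Balaban1987RG1, (0.3) p.252 ("Bᵏ(y) = {x : |x_μ − Lᵏy_μ| ≤ (Lᵏ−1)/2}"); Balaban1985RegularSpaces, (1.6) p.77, (1.19) p.79] -/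
theorem underZ_iff_under_add_ctrShift {L : ℕ} (hL : Odd L) {m n : ℕ} (hmn : m ≤ n) (y x : Site d) :
    UnderZ L m y x ↔ Under L m (y + fun _ => (ctrShift L (n - m) : ℤ)) (x + fun _ => (ctrShift L n : ℤ)) := by
  have hc : 2 * (ctrShift L m : ℤ) + 1 = (L : ℤ) ^ m := by exact_mod_cast two_mul_ctrShift_add_one hL m
  have hcn : (ctrShift L n : ℤ) = (L : ℤ) ^ m * ctrShift L (n - m) + ctrShift L m := by
    have h := ctrShift_add hL (n - m) m
    rwa [Nat.sub_add_cancel hmn] at h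
  simp only [UnderZ, Under, Pi.add_apply]
  rw [hcn]
  simp only [mul_add, mul_one]
  exact forall_congr' fun i => by constructor <;> rintro ⟨h1, h2⟩ <;> constructor <;> linarith

/-- ★ **The block label map** (odd `L`, `m ≤ n`): `flm L m (x + c_n) = flmZ L m x + c_{n−m}` — the engine's corner label of the shifted site is the record's centred label,
shifted at the coarser depth. [cite: Balaban1987RG1, (0.3) p.252; Balaban1985RegularSpaces, (1.6) p.77] -/
theorem flm_add_ctrShift {L : ℕ} (hL : Odd L) {m n : ℕ} (hmn : m ≤ n) (x : Site d) :
    flm L m (x + fun _ => (ctrShift L n : ℤ)) = flmZ L m x + fun _ => (ctrShift L (n - m) : ℤ) := by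
  have hcn : (ctrShift L n : ℤ) = (L : ℤ) ^ m * ctrShift L (n - m) + ctrShift L m := by
    have h := ctrShift_add hL (n - m) m
    rwa [Nat.sub_add_cancel hmn] at h
  have hL0 : ((L : ℤ) ^ m) ≠ 0 := by have := hL.pos; positivity
  funext i
  simp only [flm, flmZ, Pi.add_apply]
  rw [hcn, show x i + ((L : ℤ) ^ m * (ctrShift L (n - m) : ℤ) + (ctrShift L m : ℤ)) =
      x i + (ctrShift L m : ℤ) + (ctrShift L (n - m) : ℤ) * (L : ℤ) ^ m by ring,
    Int.add_mul_ediv_right _ _ hL0]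

/-- Same depth (`n = m`): `flm L m (x + c_m) = flmZ L m x` — the centred label IS the corner label of the half-block-shifted site. [cite: Balaban1987RG1, (0.3) p.252] -/
theorem flm_add_ctrShift_self {L : ℕ} (hL : Odd L) (m : ℕ) (x : Site d) :
    flm L m (x + fun _ => (ctrShift L m : ℤ)) = flmZ L m x := by
  have h := flm_add_ctrShift hL (le_refl m) x
  have h0 : (flmZ L m x + fun _ => (ctrShift L (m - m) : ℤ)) = flmZ L m x := by
    funext i; simp
  rwa [h0] at h

/-- Same depth: `UnderZ L m y x ↔ Under L m y (x + c_m)`. [cite: Balaban1987RG1, (0.3) p.252; Balaban1985RegularSpaces, (1.19) p.79] -/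
theorem underZ_iff_under_add_ctrShift_self {L : ℕ} (hL : Odd L) (m : ℕ) (y x : Site d) :
    UnderZ L m y x ↔ Under L m y (x + fun _ => (ctrShift L m : ℤ)) := by
  have h := underZ_iff_under_add_ctrShift hL (le_refl m) y x
  have h0 : (y + fun _ => (ctrShift L (m - m) : ℤ)) = y := by
    funext i; simp
  rwa [h0] at h

end Literature.MathematicalPhysics.QuantumFieldTheory.Balaban1983to89.B8Eq131CubesRecDictionary

/-! ## Axiom audit (gate whitelist: `propext`, `Classical.choice`, `Quot.sound`) -/
#print axioms Literature.MathematicalPhysics.QuantumFieldTheory.Balaban1983to89.B8Eq131CubesRecDictionary.mem_cubeZ_iff_add_ctrShift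
#print axioms Literature.MathematicalPhysics.QuantumFieldTheory.Balaban1983to89.B8Eq131CubesRecDictionary.mem_lamPZ_iff_add_ctrShift
#print axioms Literature.MathematicalPhysics.QuantumFieldTheory.Balaban1983to89.B8Eq131CubesRecDictionary.underZ_iff_under_add_ctrShift
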